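import Summits.KontsevichZagierPeriods.KontsevichZagierPeriods.Theorems.SoloInformedCurveSectorPoly

/-!
# Weights with a Nash `y`-primitive are in the curve sector (Theorem XVI-N)

Solo programme `solo-KontsevichZagierPeriods-informed`, session s32, line "the curve sector".
The kernel form of the `Q = 0` half of the Green criterion (Theorem XVI (a) of `paper/paper.md`
§6novies) for Nash data, obtained from the Jacobian criterion (Theorem XVI-J,
`SoloInformedCurveSectorJacobian.lean`) with the NASH SHEAR `Φ = (x, W(x, y))`:

* `soloInformed_det_shearCLM` — `det (v ↦ (v₀, L v)) = L(e₁)`.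
* `soloInformed_hasDerivAt_update_of_hasFDerivAt` — the derivative of `s ↦ W(x, s)` is `W'(e₁)`.
* `soloInformed_injOn_nashShear` — `(x, W)` is injective on a vertically convex set on which
  `∂W/∂y > 0`.
* `soloInformed_per_mem_span_of_hasFDerivAt_pos` — **THEOREM XVI-N⁺.** If `r = [D, w]` has bounded,
  vertically convex domain, `W` is `ℚ`-semialgebraic and bounded on `D`, differentiable at every point
  of `D` with `∂W/∂y = w > 0` on `D`, then `Per r ∈ soloInformedKappaSpan`.
* `soloInformed_per_mem_span_of_hasFDerivAt` — **THEOREM XVI-N.** The same without the sign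
  condition when `∂W/∂y` is bounded on `D`: `[D, ∂W/∂y] = [D, ∂(W + My)/∂y] − M·[D, 1]`.

After a cylindrical decomposition adapted to `W` every cell is vertically convex with `W` Nash on
it, so these two statements are what the paper's Newton–Leibniz descent proves cell by cell — here by
ONE application of rule (2) per cell and no one-sided limits.

References: M. Kontsevich, D. Zagier, *Periods* (2001), §1.2, rules (1), (2) [KontsevichZagier2001];
J. Bochnak, M. Coste, M.-F. Roy, *Real algebraic geometry* (1998), §2.2, Prop. 2.2.6
[BochnakCosteRoy1998].
-/

noncomputable section

open MeasureTheory Set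
open Literature.ModelTheory.ExponentialFields Literature.NumberTheory.Transcendental
open Literature.NumberTheory.Transcendental.KZ

namespace Summit.KontsevichZagierPeriods.KontsevichZagierPeriods.Theorems

/-! ## 1. The derivative of the Nash shear and its determinant -/

/-- A linear form on `ℝ²` in coordinates: `L v = v₀ L(e₀) + v₁ L(e₁)`. -/
theorem soloInformed_clm_apply_fin_two (L : (Fin 2 → ℝ) →L[ℝ] ℝ) (v : Fin 2 → ℝ) :
    L v = v 0 * L (Pi.single 0 1) + v 1 * L (Pi.single 1 1) := by
  have e : v = v 0 • (Pi.single 0 1 : Fin 2 → ℝ) + v 1 • (Pi.single 1 1 : Fin 2 → ℝ) := by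
    ext i
    fin_cases i <;> simp
  calc L v = L (v 0 • (Pi.single 0 1 : Fin 2 → ℝ) + v 1 • (Pi.single 1 1 : Fin 2 → ℝ)) := by
        rw [← e]
    _ = v 0 * L (Pi.single 0 1) + v 1 * L (Pi.single 1 1) := by
        rw [map_add, map_smul, map_smul, smul_eq_mul, smul_eq_mul]

/-- **Determinant of the shear derivative** `v ↦ (v₀, L v)`: it is `L(e₁) = ∂W/∂y`. -/
theorem soloInformed_det_shearCLM (L : (Fin 2 → ℝ) →L[ℝ] ℝ) :
    (ContinuousLinearMap.pi ![ContinuousLinearMap.proj 0, L] :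
        (Fin 2 → ℝ) →L[ℝ] (Fin 2 → ℝ)).det = L (Pi.single 1 1) := by
  have h : ((ContinuousLinearMap.pi ![ContinuousLinearMap.proj 0, L] :
        (Fin 2 → ℝ) →L[ℝ] (Fin 2 → ℝ)) : (Fin 2 → ℝ) →ₗ[ℝ] (Fin 2 → ℝ)) =
      Matrix.toLin' !![1, 0; L (Pi.single 0 1), L (Pi.single 1 1)] := by
    refine LinearMap.ext fun v => funext fun j => ?_
    fin_cases j
    · simp [Matrix.toLin'_apply, Matrix.mulVec, dotProduct, Fin.sum_univ_two]
    · simp [Matrix.toLin'_apply, Matrix.mulVec, dotProduct, Fin.sum_univ_two,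
        soloInformed_clm_apply_fin_two L v, mul_comm]
  rw [ContinuousLinearMap.det, h, LinearMap.det_toLin', Matrix.det_fin_two_of]
  ring

/-- The derivative of `s ↦ W(z₀, s)` at `t` is `W'(z₀, t)(e₁)`. -/
theorem soloInformed_hasDerivAt_update_of_hasFDerivAt {W : (Fin 2 → ℝ) → ℝ}
    {L : (Fin 2 → ℝ) →L[ℝ] ℝ} (z : Fin 2 → ℝ) {t : ℝ}
    (h : HasFDerivAt W L (Function.update z 1 t)) :
    HasDerivAt (fun s : ℝ => W (Function.update z 1 s)) (L (Pi.single 1 1)) t :=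
  h.comp_hasDerivAt t (hasDerivAt_update z 1 t)

/-- **The Nash shear `(x, W)` is injective** on a vertically convex set on which `∂W/∂y > 0`. -/
theorem soloInformed_injOn_nashShear {D : Set (Fin 2 → ℝ)}
    (hconv : ∀ z ∈ D, ∀ w ∈ D, z 0 = w 0 → ∀ s ∈ uIcc (z 1) (w 1), Function.update z 1 s ∈ D)
    (W : (Fin 2 → ℝ) → ℝ) (W' : (Fin 2 → ℝ) → (Fin 2 → ℝ) →L[ℝ] ℝ)
    (hWd : ∀ z ∈ D, HasFDerivAt W (W' z) z) (hpos : ∀ z ∈ D, 0 < W' z (Pi.single 1 1)) :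
    InjOn (fun z : Fin 2 → ℝ => (![z 0, W z] : Fin 2 → ℝ)) D := by
  intro z hz w hw hzw
  have h0 : z 0 = w 0 := by simpa using congr_fun hzw 0
  have h1 : W z = W w := by simpa using congr_fun hzw 1
  have hseg : ∀ s ∈ uIcc (z 1) (w 1), Function.update z 1 s ∈ D := hconv z hz w hw h0
  have hmono : StrictMonoOn (fun s : ℝ => W (Function.update z 1 s)) (uIcc (z 1) (w 1)) := by
    refine strictMonoOn_of_deriv_pos (convex_uIcc _ _) ?_ fun t ht => ?_
    · exact HasDerivAt.continuousOn fun t ht =>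
        soloInformed_hasDerivAt_update_of_hasFDerivAt z (hWd _ (hseg t ht))
    · rw [(soloInformed_hasDerivAt_update_of_hasFDerivAt z
        (hWd _ (hseg t (interior_subset ht)))).deriv]
      exact hpos _ (hseg t (interior_subset ht))
  have hw' : w = Function.update z 1 (w 1) := by
    ext i
    fin_cases i
    · simp [h0]
    · simp
  have heq : W (Function.update z 1 (z 1)) = W (Function.update z 1 (w 1)) := by
    rw [Function.update_eq_self, h1, ← hw']
  have h11 : z 1 = w 1 := hmono.injOn left_mem_uIcc right_mem_uIcc heq
  rw [hw', ← h11, Function.update_eq_self]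

/-! ## 2. THEOREM XVI-N -/

/-- **THEOREM XVI-N⁺ (Nash `y`-primitive, positive case).** Let `r = [D, w]` have dimension two with
`D` bounded and vertically convex, and let `W` be `ℚ`-semialgebraic and bounded on `D`,
differentiable at every point of `D` with derivative `W'`, such that `w = ∂W/∂y = W'(e₁) > 0` on
`D`. Then `Per r ∈ soloInformedKappaSpan`: the Nash shear `Φ = (x, W)` is injective with Jacobian
`w` and bounded image, so Theorem XVI-J applies (`[D, w] ≡ [Φ(D), 1]`, rule (2)).
[Kontsevich–Zagier 2001, §1.2, rule (2); BCR 1998, §2.2] -/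
theorem soloInformed_per_mem_span_of_hasFDerivAt_pos (r : IntegralRep 2)
    (hb : Bornology.IsBounded r.domain)
    (hconv : ∀ z ∈ r.domain, ∀ w ∈ r.domain, z 0 = w 0 →
      ∀ s ∈ uIcc (z 1) (w 1), Function.update z 1 s ∈ r.domain)
    (W : (Fin 2 → ℝ) → ℝ) (W' : (Fin 2 → ℝ) → (Fin 2 → ℝ) →L[ℝ] ℝ)
    (hWs : IsSemialgebraicFunOn ℚ r.domain W) (hWd : ∀ z ∈ r.domain, HasFDerivAt W (W' z) z)
    (B : ℝ) (hB : ∀ z ∈ r.domain, |W z| ≤ B)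
    (hpos : ∀ z ∈ r.domain, 0 < W' z (Pi.single 1 1))
    (hr : ∀ z ∈ r.domain, r.integrand z = W' z (Pi.single 1 1)) :
    soloInformedPer r ∈ soloInformedKappaSpan := by
  obtain ⟨R, -, hR⟩ := soloInformed_exists_abs_le_of_isBounded hb
  -- the Nash shear and its derivative
  let Φ : (Fin 2 → ℝ) → (Fin 2 → ℝ) := fun z => ![z 0, W z]
  let Φ' : (Fin 2 → ℝ) → (Fin 2 → ℝ) →L[ℝ] (Fin 2 → ℝ) :=
    fun z => ContinuousLinearMap.pi ![ContinuousLinearMap.proj 0, W' z]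
  have hsa : IsSemialgebraicMapOn ℚ r.domain Φ := by
    refine IsSemialgebraicMapOn.of_forall r.isSemialgebraic_domain fun j => ?_
    fin_cases j
    · exact (isSemialgebraicFunOn_aeval r.isSemialgebraic_domain (MvPolynomial.X 0)).congr
        fun z _ => by simp [Φ]
    · exact hWs.congr fun z _ => by simp [Φ]
  have hd : ∀ z ∈ r.domain, HasFDerivWithinAt Φ (Φ' z) r.domain z := by
    intro z hz
    refine hasFDerivWithinAt_pi'.2 fun j => ?_
    fin_cases j
    · have hc : (ContinuousLinearMap.proj (R := ℝ) (φ := fun _ : Fin 2 => ℝ) 0).comp (Φ' z) =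
          ContinuousLinearMap.proj 0 := by
        ext v
        simp [Φ']
      simpa [hc, Φ] using hasFDerivWithinAt_apply (𝕜 := ℝ) 0 z r.domain
    · have hc : (ContinuousLinearMap.proj (R := ℝ) (φ := fun _ : Fin 2 => ℝ) 1).comp (Φ' z) =
          W' z := by
        ext v
        simp [Φ']
      simpa [hc, Φ] using (hWd z hz).hasFDerivWithinAt (s := r.domain)
  have hinj : InjOn Φ r.domain := soloInformed_injOn_nashShear hconv W W' hWd hpos
  have hsub : Φ '' r.domain ⊆ {u : Fin 2 → ℝ | ∀ i, |u i| ≤ max R B} := by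
    rintro _ ⟨z, hz, rfl⟩ i
    fin_cases i
    · simpa [Φ] using (hR z hz 0).trans (le_max_left _ _)
    · simpa [Φ] using (hB z hz).trans (le_max_right _ _)
  have hbd : Bornology.IsBounded (Φ '' r.domain) :=
    (soloInformed_isCompact_box (n := 2) (max R B)).isBounded.subset hsub
  have hIm : IsSemialgebraic ℚ (Φ '' r.domain) :=
    IsSemialgebraicMapOn.isSemialgebraic_image_holds hsa Subset.rfl r.isSemialgebraic_domain
  -- rule (2): `[D, ∂W/∂y] ≡ [Φ(D), 1]`
  let r' : IntegralRep 2 := ⟨Φ '' r.domain, fun _ => 1, hIm,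
    by simpa using isSemialgebraicFunOn_ratCast hIm 1, integrableOn_const hbd.measure_lt_top.ne⟩
  have hrel : of r - of r' ∈ relations := by
    refine changeOfVariablesRel_subset_relations ⟨2, r, r', Φ, Φ', hsa, hd, hinj, rfl,
      fun z hz => ?_, rfl⟩
    show r.integrand z = 1 * |(Φ' z).det|
    rw [hr z hz, one_mul, soloInformed_det_shearCLM, abs_of_pos (hpos z hz)]
  rw [soloInformedPer_congr hrel]
  exact soloInformed_per_mem_span_planar_of_isBounded r' hbd fun _ _ => rfl

/-- **THEOREM XVI-N (Nash `y`-primitive, bounded derivative).** As in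
`soloInformed_per_mem_span_of_hasFDerivAt_pos`, but instead of `∂W/∂y > 0` assume only
`|∂W/∂y| < M` on `D` for some `M ∈ ℕ`. Then `Per [D, ∂W/∂y] ∈ soloInformedKappaSpan`:
`[D, ∂W/∂y] = [D, ∂(W + My)/∂y] − [D, M]` (rule (1)), both shear moves.
[Kontsevich–Zagier 2001, §1.2, rules (1), (2); BCR 1998, Prop. 2.2.6] -/
theorem soloInformed_per_mem_span_of_hasFDerivAt (r : IntegralRep 2)
    (hb : Bornology.IsBounded r.domain)
    (hconv : ∀ z ∈ r.domain, ∀ w ∈ r.domain, z 0 = w 0 →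
      ∀ s ∈ uIcc (z 1) (w 1), Function.update z 1 s ∈ r.domain)
    (W : (Fin 2 → ℝ) → ℝ) (W' : (Fin 2 → ℝ) → (Fin 2 → ℝ) →L[ℝ] ℝ)
    (hWs : IsSemialgebraicFunOn ℚ r.domain W) (hWd : ∀ z ∈ r.domain, HasFDerivAt W (W' z) z)
    (B : ℝ) (hB : ∀ z ∈ r.domain, |W z| ≤ B)
    (M : ℕ) (hM : ∀ z ∈ r.domain, |W' z (Pi.single 1 1)| < M)
    (hr : ∀ z ∈ r.domain, r.integrand z = W' z (Pi.single 1 1)) :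
    soloInformedPer r ∈ soloInformedKappaSpan := by
  obtain ⟨R, -, hR⟩ := soloInformed_exists_abs_le_of_isBounded hb
  have hfin : volume r.domain ≠ ⊤ := hb.measure_lt_top.ne
  -- the shifted primitive `W₁ = W + M y` and its derivative
  let W₁ : (Fin 2 → ℝ) → ℝ := fun z => W z + M * z 1
  let W₁' : (Fin 2 → ℝ) → (Fin 2 → ℝ) →L[ℝ] ℝ :=
    fun z => W' z + (M : ℝ) • ContinuousLinearMap.proj 1
  have hW₁d : ∀ z ∈ r.domain, HasFDerivAt W₁ (W₁' z) z := fun z hz =>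
    (hWd z hz).add ((hasFDerivAt_apply 1 z).const_smul (M : ℝ))
  have hW₁e : ∀ z, W₁' z (Pi.single 1 1) = W' z (Pi.single 1 1) + M := fun z => by
    simp [W₁']
  have hW₁s : IsSemialgebraicFunOn ℚ r.domain W₁ :=
    IsSemialgebraicFunOn.add_holds hWs
      ((isSemialgebraicFunOn_aeval r.isSemialgebraic_domain
        (MvPolynomial.C (M : ℚ) * MvPolynomial.X 1)).congr fun z _ => by simp)
  -- the two representations `[D, ∂W/∂y + M]` and `[D, M]`
  let rq : IntegralRep 2 := ⟨r.domain, fun z => r.integrand z + M, r.isSemialgebraic_domain,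
    IsSemialgebraicFunOn.add_holds r.isSemialgebraicFunOn_integrand
      (isSemialgebraicFunOn_natCast r.isSemialgebraic_domain M),
    r.integrableOn.add (integrableOn_const hfin)⟩
  let rM : IntegralRep 2 := ⟨r.domain, fun _ => (M : ℝ), r.isSemialgebraic_domain,
    isSemialgebraicFunOn_natCast r.isSemialgebraic_domain M, integrableOn_const hfin⟩
  have hadd : of rq - of r - of rM ∈ relations :=
    integrandAddRel_subset_relations ⟨2, rq, r, rM, rfl, rfl, fun z _ => by simp [rq, rM], rfl⟩
  have hq : soloInformedPer rq ∈ soloInformedKappaSpan := by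
    refine soloInformed_per_mem_span_of_hasFDerivAt_pos rq hb hconv W₁ W₁' hW₁s hW₁d
      (B + M * R) (fun z hz => ?_) (fun z hz => ?_) fun z hz => ?_
    · calc |W₁ z| ≤ |W z| + |(M : ℝ) * z 1| := abs_add_le _ _
        _ ≤ B + M * R := add_le_add (hB z hz) (by
            rw [abs_mul, Nat.abs_cast]; exact mul_le_mul_of_nonneg_left (hR z hz 1) M.cast_nonneg)
    · rw [hW₁e]
      have h := abs_lt.1 (hM z hz)
      linarith [h.1]
    · simp [rq, hW₁e, hr z hz]
  have hMmem : soloInformedPer rM ∈ soloInformedKappaSpan :=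
    soloInformed_per_mem_span_poly rM hb (MvPolynomial.C (M : ℚ)) fun z _ => by simp [rM]
  have hPer : soloInformedPer r = soloInformedPer rq - soloInformedPer rM :=
    eq_sub_of_add_eq (soloInformedPer_add hadd).symm
  rw [hPer]
  exact sub_mem hq hMmem

end Summit.KontsevichZagierPeriods.KontsevichZagierPeriods.Theorems
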